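import Summits.QuantumFields.YangMills.Theorems.BalabanUVNodesN15CurvedPerturbationLettersTwoGridUN
import HarnessLib

/-!
# Route «BalabanUVNodes» (cluster K4 «SpineRates»), Track-A DAG node N15 = NE2, BACKGROUND LAYER — THE TWO-GRID DEFECT `hDV` OF THE CURVED SPECIES AT A GENUINE `U(N)` PAIR
# (perturbation `U`, CURVED background `V`), PURE GROUP LEVEL: FILE 1's `hasMaj_idef_unstackM_curvCoef_rate` with every transporter-level letter ∕ fit read off the bond variables —
# sizes of `η⁻¹(U − 1)` and of the rescaled COVARIANT backward difference `η⁻²(U_μ(x) − V₋ᴴU₋V₋)`, closeness of `U`, of the translated background `V`, of the transported `V₋ᴴU₋V₋`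
# across the grids, and the rescaled fits — no chart, no logarithm

Cell `pub-ymgap`, seat `pub-ymgap-dag-n15-w2` (WIDTH SEAT 2∕3 on node N15, director-ym №197 ∕ HUMAN RULING D-0149), g5, sixth piece (bus CLAIM-6) — the curved-base-point twin of g5 FILE 5
`…CurvedPerturbationLettersTwoGridUN` (flat base point).  `bears_on: R4∕N15 · K3⁸ SpineGivenEndpointR13SepCoPHV (stmt-QuantumFields-27366)`.  Filed
`--kind proof --supports stmt-QuantumFields-27366 --as helper` — COUNT-NEUTRAL.  Theorems only; 0 `def`, 0 `sorry`.  Imports BY NAME g5 FILE 5 (`uN_abs_smul_transporter_sub_one_le`,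
`uN_abs_smul_transporter_fit_le`, `uN_abs_smul_covShift_fit_le`; through it FILE 2 `uN_covShiftDefect_conj_eq` ∕ `uN_conj_unitary` ∕ `uN_abs_coordMat_conj_sub_entry_le`, FILE 1
`hasMaj_idef_unstackM_curvCoef_rate`, g2 `uN_coordMat_conj_orthogonal`, n15-w3 file 1 `curvCoefA_inl` ∕ `covShiftDefect`); nothing in the tree is modified, no landed name re-declared.

WHY.  FILE 5 typed the flat-base-point `hDV` for genuine `U(N)` bond fields from group-level data.  At a CURVED `U(N)` base point `R = coordMat e (Ad_V)` FILE 1's abstract defect displays two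
more fits — `o_R` (the translated background transporters across the grids) and `o_g` (the rescaled COVARIANT backward defects `η⁻²(S_μ − R₋ᵀS₋R₋)`) — and by FILE 2's
`uN_covShiftDefect_conj_eq` the latter IS `η⁻²(coordMat e (Ad_{U_μ(x)}) − coordMat e (Ad_{W}))`, `W = V₋ᴴU₋V₋` unitary; so FILE 5's rescaled two-sided splittings apply verbatim with
`v := W`.  THIS FILE states the knit:
* ★★★ `uN_hasMaj_idef_unstackM_curvCoef_group_rate` — unitary `U, V` (coarse, `η`, `τ`) and `U′, V′` (fine, `η′`, `τ′`) along `π`; sizes `‖η⁻¹(U − 1)‖_F ≤ p` (both grids),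
  `‖η⁻²(U_μ(x) − W_μ(x))‖_F ≤ q` (both grids, `W_μ(x) = V_μ(x−e_μ)ᴴU_μ(x−e_μ)V_μ(x−e_μ)`); closeness `‖U′_μ(x′) − U_μ(πx′)‖_F ≤ d₀`, translated `≤ d_t`, translated background
  `‖V′_μ(x′−e_μ) − V_μ(πx′−e_μ)‖_F ≤ d_R`, transported `‖W′_μ(x′) − W_μ(πx′)‖_F ≤ d_W`; rescaled fits `o_a` (plain), `o_t` (translated), `o_g` (covariant backward differences); `d(y,y) = 0` ⟹
  `𝔇(V̂_{R′}(S′), V̂_R(S)) ≤ o_V(κ_e 2√|n| p, κ_e(2√|n| o_a + p d₀), κ_e(2√|n| o_t + p d_t), κ_e 2√|n| d_R, κ_e(2√|n| o_g + q(d₀ + d_W)))(1 + |J ⊕ J|)·e^{−δ_Vd}` for every `δ_V` — files 24∕45's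
  slot for a genuine non-abelian perturbation of a genuine non-abelian background, chart-free.

HONEST FRAMING ∕ LIMITS.  Bookkeeping over DISPLAYED bond-variable data ((3.35)–(3.37) p. 396, (3.52)–(3.53) p. 400, Thm 3.14 pp. 426–427 of [Balaban1985BackgroundPropagators] = SHAPES);
the closeness letters `d₀, d_t, d_R, d_W` and the rescaled fits are HYPOTHESES (two-grid comparisons of bond variables = the averaging ∕ NE3 currency, lane-held; `d_W` is NOT reduced to
`d₀, d_R` here); constants crude.  Nothing of [B5]∕[B6]∕[B9] asserted; NE2⁺ NOT PRINTED, NOT proved; N15 NOT discharged; K3⁸ OPEN, skeleton v6 untouched; counts of record UNMOVED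
(typed 28∕28 · discharged 5∕27 · A 5∕28); one finite 𝕋⁴ at fixed ε — NOT ℝ⁴ ∕ OS ∕ mass gap ∕ Clay; R4 closes the conditional finite-𝕋⁴ rung `BalabanLadder.UV` only.  Restate-immune.
-/

set_option autoImplicit false

noncomputable section
open scoped BigOperators Matrix Matrix.Norms.Frobenius

namespace Summit.QuantumFields.YangMills.BalabanUVNodes.N15.CurvedSpecies

open Literature.MathematicalPhysics.QuantumFieldTheory.Balaban1983to89
open Literature.MathematicalPhysics.QuantumFieldTheory.Balaban1983to89.B11SectG (BlockNorm HasMaj)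
open Literature.MathematicalPhysics.QuantumFieldTheory.Balaban1983to89.T4EtaRateDefect (idef)
open Literature.MathematicalPhysics.QuantumFieldTheory.Balaban1983to89.T4EtaRateCoeffDefect (pull)
open Summit.QuantumFields.YangMills.BalabanUVNodes.N15.MatrixSpecies (liftMap liftBlk coordMat basisConst basisConst_nonneg)
open Summit.QuantumFields.YangMills.BalabanUVNodes.N15.BackgroundLayer (liftPair blkPair unstackM)
open Literature.Barriers.QuantumFields (traceForm)

variable {n : Type} [Fintype n] [DecidableEq n] {κ : Type} [Fintype κ] [DecidableEq κ] (e : Matrix n n ℂ ≃L[ℝ] (κ → ℝ))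
variable {X X' J : Type} [Fintype X] [Fintype X'] [DecidableEq X] [DecidableEq X'] [Fintype J] [DecidableEq J] {g : B6.Geometry} (blk : X → g.Site) (π : X' → X)
  (η η' : ℝ) (τ : J → X ≃ X) (τ' : J → X' ≃ X') (U V : J → X → Matrix n n ℂ) (U' V' : J → X' → Matrix n n ℂ)

omit [DecidableEq X] [DecidableEq X'] [DecidableEq J] in
/-- ★★★ **`hDV` OF THE CURVED SPECIES AT A GENUINE `U(N)` PAIR ON TWO GRIDS, GROUP-LEVEL DATA ONLY** (see the module docstring for the letter list): for `S = coordMat e (Ad_U)`,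
`R = coordMat e (Ad_V)` (coarse) and `S′, R′` (fine), FILE 1's `hasMaj_idef_unstackM_curvCoef_rate` holds with
`(p, o_a, o_t, o_R, o_g) ↦ (κ_e 2√|n| p, κ_e(2√|n| o_a + p d₀), κ_e(2√|n| o_t + p d_t), κ_e 2√|n| d_R, κ_e(2√|n| o_g + q(d₀ + d_W)))`, every `δ_V`.
[cite: Balaban1985BackgroundPropagators, (3.35)–(3.37) p.396, (3.52)–(3.53) p.400, Thm 3.14 pp.426–427 (shapes)] -/
theorem uN_hasMaj_idef_unstackM_curvCoef_group_rate (he : ∀ A B : Matrix n n ℂ, traceForm A B = e A ⬝ᵥ e B) (hU : ∀ μ x, (U μ x)ᴴ * U μ x = 1) (hV : ∀ μ x, (V μ x)ᴴ * V μ x = 1)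
    (hU' : ∀ μ x', (U' μ x')ᴴ * U' μ x' = 1) (hV' : ∀ μ x', (V' μ x')ᴴ * V' μ x' = 1) (hd0 : ∀ y : g.Site, g.dist y y = 0) {p q d₀ dt dR dW oa ot og : ℝ} (hp0 : 0 ≤ p)
    (hq : 0 ≤ q) (hd₀ : 0 ≤ d₀) (hdt : 0 ≤ dt) (hdR : 0 ≤ dR) (hdW : 0 ≤ dW) (hoa : 0 ≤ oa) (hot : 0 ≤ ot) (hog : 0 ≤ og)
    -- sizes, both grids
    (hp : ∀ μ x, ‖η⁻¹ • (U μ x - 1)‖ ≤ p) (hp' : ∀ μ x', ‖η'⁻¹ • (U' μ x' - 1)‖ ≤ p)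
    (hqU : ∀ μ x, ‖(η⁻¹ * η⁻¹) • (U μ x - (V μ ((τ μ).symm x))ᴴ * U μ ((τ μ).symm x) * V μ ((τ μ).symm x))‖ ≤ q)
    (hqU' : ∀ μ x', ‖(η'⁻¹ * η'⁻¹) • (U' μ x' - (V' μ ((τ' μ).symm x'))ᴴ * U' μ ((τ' μ).symm x') * V' μ ((τ' μ).symm x'))‖ ≤ q)
    -- closeness across the grids
    (hclose : ∀ μ x', ‖U' μ x' - U μ (π x')‖ ≤ d₀) (hcloseT : ∀ μ x', ‖U' μ ((τ' μ).symm x') - U μ ((τ μ).symm (π x'))‖ ≤ dt)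
    (hcloseR : ∀ μ x', ‖V' μ ((τ' μ).symm x') - V μ ((τ μ).symm (π x'))‖ ≤ dR)
    (hcloseW : ∀ μ x', ‖(V' μ ((τ' μ).symm x'))ᴴ * U' μ ((τ' μ).symm x') * V' μ ((τ' μ).symm x') -
      (V μ ((τ μ).symm (π x')))ᴴ * U μ ((τ μ).symm (π x')) * V μ ((τ μ).symm (π x'))‖ ≤ dW)
    -- rescaled fits
    (hfa : ∀ μ x', ‖η'⁻¹ • (U' μ x' - 1) - η⁻¹ • (U μ (π x') - 1)‖ ≤ oa)
    (hfat : ∀ μ x', ‖η'⁻¹ • (U' μ ((τ' μ).symm x') - 1) - η⁻¹ • (U μ ((τ μ).symm (π x')) - 1)‖ ≤ ot)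
    (hfg : ∀ μ x', ‖(η'⁻¹ * η'⁻¹) • (U' μ x' - (V' μ ((τ' μ).symm x'))ᴴ * U' μ ((τ' μ).symm x') * V' μ ((τ' μ).symm x')) -
      (η⁻¹ * η⁻¹) • (U μ (π x') - (V μ ((τ μ).symm (π x')))ᴴ * U μ ((τ μ).symm (π x')) * V μ ((τ μ).symm (π x')))‖ ≤ og) (δV : ℝ) :
    HasMaj (BlockNorm.ofBlocks g (blkPair (liftBlk blk κ))) (BlockNorm.ofBlocks g (liftBlk (blk ∘ π) κ))
      (idef (pull (liftPair (liftMap π κ))) (pull (liftMap π κ))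
        (unstackM (curvCoefC η' τ' (fun μ x' => coordMat e (ContinuousLinearMap.mulLeftRight ℝ (Matrix n n ℂ) (V' μ x') (V' μ x')ᴴ))
            (fun μ x' => coordMat e (ContinuousLinearMap.mulLeftRight ℝ (Matrix n n ℂ) (U' μ x') (U' μ x')ᴴ)))
          (curvCoefA η' τ' (fun μ x' => coordMat e (ContinuousLinearMap.mulLeftRight ℝ (Matrix n n ℂ) (V' μ x') (V' μ x')ᴴ))
            (fun μ x' => coordMat e (ContinuousLinearMap.mulLeftRight ℝ (Matrix n n ℂ) (U' μ x') (U' μ x')ᴴ))))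
        (unstackM (curvCoefC η τ (fun μ x => coordMat e (ContinuousLinearMap.mulLeftRight ℝ (Matrix n n ℂ) (V μ x) (V μ x)ᴴ))
            (fun μ x => coordMat e (ContinuousLinearMap.mulLeftRight ℝ (Matrix n n ℂ) (U μ x) (U μ x)ᴴ)))
          (curvCoefA η τ (fun μ x => coordMat e (ContinuousLinearMap.mulLeftRight ℝ (Matrix n n ℂ) (V μ x) (V μ x)ᴴ))
            (fun μ x => coordMat e (ContinuousLinearMap.mulLeftRight ℝ (Matrix n n ℂ) (U μ x) (U μ x)ᴴ)))))
      (fun y y' => curvFitLetter κ J (basisConst e * (2 * Real.sqrt (Fintype.card n) * p)) (basisConst e * (2 * Real.sqrt (Fintype.card n) * oa + p * d₀))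
          (basisConst e * (2 * Real.sqrt (Fintype.card n) * ot + p * dt)) (basisConst e * (2 * Real.sqrt (Fintype.card n) * dR))
          (basisConst e * (2 * Real.sqrt (Fintype.card n) * og + q * (d₀ + dW))) * (1 + Fintype.card (J ⊕ J)) * Real.exp (-(δV * g.dist y y'))) := by
  have hκ : 0 ≤ basisConst e := basisConst_nonneg e
  have hs : 0 ≤ 2 * Real.sqrt (Fintype.card n) := by positivity
  refine hasMaj_idef_unstackM_curvCoef_rate blk π η η' τ τ' _ _ _ _ hd0 (by positivity) (by positivity) (by positivity) (by positivity) (by positivity)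
    (fun μ x => (uN_coordMat_conj_orthogonal e he (hU μ x)).2) (fun μ x => (uN_coordMat_conj_orthogonal e he (hV μ x)).1)
    (fun μ x => (uN_coordMat_conj_orthogonal e he (hV μ x)).2) (fun μ x' => (uN_coordMat_conj_orthogonal e he (hU' μ x')).2)
    (fun μ x' => (uN_coordMat_conj_orthogonal e he (hV' μ x')).1) (fun μ x' => (uN_coordMat_conj_orthogonal e he (hV' μ x')).2)
    (fun μ x i j => ?_) (fun μ x' i j => ?_) (fun μ x' i j => ?_) (fun μ x' i j => ?_) (fun μ x' i j => ?_) (fun μ x' i j => ?_) δV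
  · rw [curvCoefA_inl]
    exact (uN_abs_smul_transporter_sub_one_le e (hU μ x) η⁻¹ i j).trans (mul_le_mul_of_nonneg_left (mul_le_mul_of_nonneg_left (hp μ x) hs) hκ)
  · rw [curvCoefA_inl]
    exact (uN_abs_smul_transporter_sub_one_le e (hU' μ x') η'⁻¹ i j).trans (mul_le_mul_of_nonneg_left (mul_le_mul_of_nonneg_left (hp' μ x') hs) hκ)
  · rw [curvCoefA_inl, curvCoefA_inl]
    exact uN_abs_smul_transporter_fit_le e (hU' μ x') η⁻¹ η'⁻¹ (hp μ (π x')) (hfa μ x') (hclose μ x') i j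
  · rw [curvCoefA_inl, curvCoefA_inl]
    exact uN_abs_smul_transporter_fit_le e (hU' μ ((τ' μ).symm x')) η⁻¹ η'⁻¹ (hp μ ((τ μ).symm (π x'))) (hfat μ x') (hcloseT μ x') i j
  · exact (uN_abs_coordMat_conj_sub_entry_le e (hV μ ((τ μ).symm (π x'))) (hV' μ ((τ' μ).symm x')) i j).trans
      (mul_le_mul_of_nonneg_left (mul_le_mul_of_nonneg_left (hcloseR μ x') hs) hκ)
  · rw [uN_covShiftDefect_conj_eq e τ' U' V' he hV' μ x', uN_covShiftDefect_conj_eq e τ U V he hV μ (π x')]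
    exact uN_abs_smul_covShift_fit_le e (hU' μ x') (uN_conj_unitary (hU μ _) (hV μ _)) (η⁻¹ * η⁻¹) (η'⁻¹ * η'⁻¹) (hqU μ (π x')) (hqU' μ x') (hfg μ x')
      (hclose μ x') (hcloseW μ x') i j

end Summit.QuantumFields.YangMills.BalabanUVNodes.N15.CurvedSpecies

end
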